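import Literature.NumberTheory.Automorphic.GodementJacquetRankOneEntire
import Literature.NumberTheory.Automorphic.PairLFunctionPolesGLOneBoundaryProofs
import Literature.NumberTheory.Automorphic.AdelicGroupDataAutomorphicMeasureProofs
import HarnessLib

/-!
# Arthur–Clozel (2.2) on the line `Re s = 1`, `s ≠ 1`, for `GL_1 × GL_1` over every number field,
# unconditionally; Hecke–Landau `L^S(1 + it, ψ) ≠ 0`

Topic `NumberTheory/Automorphic`; namespace `Literature.NumberTheory.Automorphic` (and one theorem
on Hecke characters in `Literature.NumberTheory.GaloisRepresentations.HeckeCharacter`). Proof file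
(theorems only: no definition, no named fact, no instance) under the named fact
`JacquetShalika1981_partialPairL_boundary_of_ne_one` of `PairLFunctionPoles` — Arthur–Clozel,
*Simple algebras, base change, and the advanced theory of the trace formula*, Ann. of Math.
Stud. 120 (1989), Ch. 3 §2, (2.2), p. 171 of the held copy: `L^S(s, π ⊗ σ)` "extends continuously
to the line `Re s = 1` with `X` removed. Moreover, it does not vanish there" — at the points
`s₀ ≠ 1` of the line, in ranks `n = m = 1`.

`PairLFunctionPolesGLOneBoundaryProofs` proved this case granted Hecke's continuation theorem in the
tree's form (`JacquetShalika1981_partialPairL_boundary_of_ne_one_one_of_tate`, hypothesis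
`∀ χ, heckeLFunction_hasEntireContinuation_of_not_isNormTwist χ`), and
`PairLFunctionPolesGLOneRatProofs` proved it for `K = ℚ`. The hypothesis served only to continue
`L(s, ψ^{±1})`, `ψ = χ_π χ_{π'} ≠ 1`, to the left of `Re s = 1`; Hecke's theorem for these
characters is now a theorem of the tree (`exists_entire_eq_partialHeckeL`,
`GodementJacquetRankOneEntire`: `L^S(s, ψ)` is entire for unitary `ψ ≠ 1` trivial on `A_G`), which
with the finite Euler factors gives continuations of the full `L(s, ψ^{±1})` to `Re s > 0`
(`exists_differentiableOn_eq_heckeLFunction_of_partial`, `PairLFunctionPolesNeConjRankOne`). So: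

* `HeckeCharacter.continuation_apply_ne_zero_of_re_eq_one_of_differentiableOn` — **Hecke–Landau on
  `Re s = 1`, half-plane form**: for unitary `χ` and `g`, `g'` holomorphic on `{Re s > 0}` with
  `g = L(·, χ)`, `g' = L(·, χ⁻¹)` on `Re s > 1`, `g(s₀) ≠ 0` whenever `Re s₀ = 1` (the proof of
  `continuation_apply_ne_zero_of_re_eq_one`, `HeckeLFunctionNonvanishingLineProofs` — twist by
  `‖·‖^{it}` and Landau's method at `s = 1` — run with `continuation_apply_one_ne_zero`, `A = 0`;
  in print Iwasawa (1964), Prop. 4.4: "`L(1 + iy; χ) ≠ 0`", proved there by the `3, 4, 1`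
  inequality);
* `exists_entire_forall_ne_zero_eq_partialHeckeL` — for unitary `ψ ≠ 1` trivial on `A_G` and
  finite `S` off which `ψ` is unramified, `L^S(s, ψ)` has an entire continuation with **no zero on
  the line `Re s = 1`**; `exists_ne_zero_tendsto_partialHeckeL_of_re_eq_one` — the limit form;
* `JacquetShalika1981_partialPairL_boundary_of_ne_one_one` (**main**) — the named fact for
  `n = m = 1` over every number field `K`, unconditionally (`ψ = 1`: `ζ_K^S(s₀) ≠ 0`, Landau 1903,
  `tendsto_tprod_eulerFactor_one_of_ne_one_numberField`; `ψ ≠ 1`: the previous item).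

With `JacquetShalika1981_partialPairL_at_one_of_ne_conj_one` (`PairLFunctionPolesNeConjRankOne`) and
`JacquetShalika1981_partialPairL_pole_of_eq_conj_one` (`PairLFunctionPolesGLOneDedekindProofs`) all of
Arthur–Clozel's (2.2)–(2.3) is now unconditional in rank one.

## References

* J. Arthur, L. Clozel, *Simple algebras, base change, and the advanced theory of the trace
  formula*, Ann. of Math. Stud. 120 (1989), Ch. 3 §2, (2.2), p. 171. [ArthurClozelAMS120]
* K. Iwasawa, *Hecke's `L`-functions* (lectures, Princeton, Spring 1964), SpringerBriefs (2019),
  Thm. 3.1 (PDF p. 58), Prop. 4.4 (PDF p. 72). [Iwasawa2019]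
* J. Tate, *Fourier analysis in number fields and Hecke's zeta-functions*, in Cassels–Fröhlich,
  *Algebraic Number Theory* (1967), Ch. XV, Thm. 4.4.1. [TateThesis1967]
* E. Landau, *Neuer Beweis des Primzahlsatzes und Beweis des Primidealsatzes*, Math. Ann. 56
  (1903), 645–670. [LandauMathAnn1903]
-/

noncomputable section

open scoped Topology NNReal
open NumberField IsDedekindDomain MeasureTheory Filter Complex Set

/-! ### Hecke–Landau on the line, half-plane form -/

namespace Literature.NumberTheory.GaloisRepresentations.HeckeCharacter

variable {K : Type} [Field K] [NumberField K]

/-- **Hecke–Landau on `Re s = 1`, half-plane form** (Iwasawa (1964), Prop. 4.4: "for any real `y`,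
`L(1 + iy; χ) ≠ 0`"): if `χ` is unitary and `L(s, χ)`, `L(s, χ⁻¹)` extend to functions `g`, `g'`
holomorphic on the half-plane `{Re s > 0}`, then `g(s₀) ≠ 0` whenever `Re s₀ = 1`. With `t = Im s₀`
and `ν = ‖·‖^{it}` (`exists_forall_apply_eq_ideleNorm_cpow`), `s ↦ g(s + it)`, `s ↦ g'(s - it)`
continue `L(s, χν)`, `L(s, (χν)⁻¹)` to `{Re s > 0}` (`heckeLFunction_mul_eq_of_forall_apply_eq_cpow`),
and `g(1 + it) ≠ 0` by Landau's method at `s = 1` (`continuation_apply_one_ne_zero` with `A = 0`).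
[cite: Iwasawa2019, Ch. 4 §4.2 Prop. 4.4] -/
theorem continuation_apply_ne_zero_of_re_eq_one_of_differentiableOn {χ : HeckeCharacter K}
    (hχ : χ.IsUnitary) {g g' : ℂ → ℂ} (hg : DifferentiableOn ℂ g {s : ℂ | 0 < s.re})
    (hg_eq : ∀ s : ℂ, 1 < s.re → g s = heckeLFunction χ s)
    (hg' : DifferentiableOn ℂ g' {s : ℂ | 0 < s.re})
    (hg'_eq : ∀ s : ℂ, 1 < s.re → g' s = heckeLFunction χ⁻¹ s) {s₀ : ℂ} (hs₀ : s₀.re = 1) :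
    g s₀ ≠ 0 := by
  set t : ℝ := s₀.im with ht
  obtain ⟨ν, hν⟩ := exists_forall_apply_eq_ideleNorm_cpow K (I * t)
  have hνu : ν.IsUnitary := isUnitary_of_forall_apply_eq_cpow hν (by simp)
  have hν' : ∀ x : ideleGroup K, ((ν⁻¹ x : ℂˣ) : ℂ) = ((ideleNorm x : ℝ) : ℂ) ^ (-(I * t)) :=
    inv_apply_of_forall_apply_eq_cpow hν
  have hs₀' : s₀ = 1 + I * t := Complex.ext (by simp [hs₀]) (by simp [ht])
  -- the translated continuations, holomorphic on the (translation-invariant) half-plane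
  have h1 : g (1 + I * t) ≠ 0 := by
    refine continuation_apply_one_ne_zero (χ := χ * ν) (hχ.mul hνu) (A := 0) one_half_pos
      (g := fun s => g (s + I * t)) (g' := fun s => g' (s - I * t))
      (hg.comp (differentiable_id.add_const _).differentiableOn fun s hs => ?_) (fun s hs => ?_)
      (hg'.comp (differentiable_id.sub_const _).differentiableOn fun s hs => ?_) (fun s hs => ?_)
    · have hs' : 0 < s.re := hs
      show 0 < (s + I * t).re
      simpa using hs'
    · have hs' : 1 < (s + I * t).re := by simpa using hs
      rw [hg_eq _ hs', heckeLFunction_mul_eq_of_forall_apply_eq_cpow χ hν s]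
    · have hs' : 0 < s.re := hs
      show 0 < (s - I * t).re
      simpa using hs'
    · have hs' : 1 < (s - I * t).re := by simpa using hs
      rw [hg'_eq _ hs', mul_inv, heckeLFunction_mul_eq_of_forall_apply_eq_cpow χ⁻¹ hν' s,
        sub_eq_add_neg]
  rwa [hs₀']

end Literature.NumberTheory.GaloisRepresentations.HeckeCharacter

namespace Literature.NumberTheory.Automorphic

open AdelicGroupData GaloisRepresentations

variable {K : Type} [Field K] [NumberField K]

/-! ### Hecke–Landau on the line for the characters of `L²(GL_1)`, unconditionally -/

open scoped Classical in
/-- **The continuation of the full `L(s, ψ)` to `Re s > 0`, with its values.** For unitary `ψ`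
unramified off the finite `T` and `g` entire with `g = L^T(·, ψ)` on `Re s > 1`,
`G(s) = (∏_{v ∈ T} (1 - c_v N v^{-s}))⁻¹ g(s)` is holomorphic on `{Re s > 0}` and equals `L(s, ψ)`
on `Re s > 1` (as `exists_differentiableOn_eq_heckeLFunction_of_partial`, keeping the formula for
`G` at every point). [cite: NeukirchANT1999, Ch. VII §8 (before (8.5))] -/
theorem differentiableOn_inv_prod_mul_and_eq_heckeLFunction {ψ : HeckeCharacter K}
    (hψ : ψ.IsUnitary) (T : Finset (HeightOneSpectrum (𝓞 K)))
    (hur : ∀ v ∉ (T : Set (HeightOneSpectrum (𝓞 K))), ψ.IsUnramifiedAt v)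
    {g : ℂ → ℂ} (hg : Differentiable ℂ g)
    (hg_eq : ∀ s : ℂ, 1 < s.re → g s =
      ∏' v : {v : HeightOneSpectrum (𝓞 K) // v ∉ (T : Set (HeightOneSpectrum (𝓞 K)))},
        (1 - ψ.valueAtUniformizer v.1 * ((Ideal.absNorm v.1.asIdeal : ℕ) : ℂ) ^ (-s))⁻¹) :
    DifferentiableOn ℂ (fun s : ℂ =>
        (∏ v ∈ T, (1 - (if ψ.IsUnramifiedAt v then ψ.valueAtUniformizer v else 0) *
          ((Ideal.absNorm v.asIdeal : ℕ) : ℂ) ^ (-s)))⁻¹ * g s) {s : ℂ | 0 < s.re} ∧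
      ∀ s : ℂ, 1 < s.re →
        (∏ v ∈ T, (1 - (if ψ.IsUnramifiedAt v then ψ.valueAtUniformizer v else 0) *
          ((Ideal.absNorm v.asIdeal : ℕ) : ℂ) ^ (-s)))⁻¹ * g s = heckeLFunction ψ s := by
  set E : ℂ → ℂ := fun s => ∏ v ∈ T, (1 - (if ψ.IsUnramifiedAt v then ψ.valueAtUniformizer v
    else 0) * ((Ideal.absNorm v.asIdeal : ℕ) : ℂ) ^ (-s)) with hE
  have hEd : Differentiable ℂ E := differentiable_finset_prod_one_sub_mul_cpow T _
  have hE0 : ∀ s ∈ {s : ℂ | 0 < s.re}, E s ≠ 0 := fun s hs =>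
    finset_prod_one_sub_mul_cpow_ne_zero T (norm_ite_valueAtUniformizer_le_one hψ) hs
  refine ⟨(hEd.differentiableOn.inv hE0).mul hg.differentiableOn, fun s hs => ?_⟩
  have hsplit := heckeLFunction_eq_prod_mul_tprod_compl hψ T hur hs
  rw [Finset.prod_inv_distrib] at hsplit
  show (E s)⁻¹ * g s = heckeLFunction ψ s
  rw [hsplit, hg_eq s hs]

/-- **Hecke–Landau on `Re s = 1` over every number field: the entire continuation of `L^S(s, ψ)`
has no zero on the line.** For a unitary Hecke character `ψ ≠ 1` of `K` trivial on `A_G = ℝ_{>0}`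
and a finite set `S` of finite places off which `ψ` is unramified, `L^S(s, ψ)` (`Re s > 1`) extends
to an entire `g` with `g(s₀) ≠ 0` for every `s₀` with `Re s₀ = 1`: continuation by Hecke–Tate
(`exists_entire_eq_partialHeckeL`, Godement–Jacquet in rank one, with an auxiliary automorphic
measure `exists_isAutomorphicMeasure_gl_holds`), for `ψ` and `ψ⁻¹`; the continuations
`E_S(s)⁻¹ g`, `E'_S(s)⁻¹ g'` of the full `L(s, ψ^{±1})` to `Re s > 0`
(`differentiableOn_inv_prod_mul_and_eq_heckeLFunction`) have no zero on the line by
`HeckeCharacter.continuation_apply_ne_zero_of_re_eq_one_of_differentiableOn`, and `E_S(s₀) ≠ 0`.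
In print: Iwasawa, Thm. 3.1 and Prop. 4.4. [cite: Iwasawa2019, Thm. 3.1 and Ch. 4 §4.2 Prop. 4.4]
[cite: TateThesis1967, Thm. 4.4.1] -/
theorem exists_entire_forall_ne_zero_eq_partialHeckeL (ψ : HeckeCharacter K) (hu : ψ.IsUnitary)
    (hA : ∀ t : ℝ≥0ˣ, ψ (posRealIdele K t) = 1) (h1 : ψ ≠ 1)
    {S : Set (HeightOneSpectrum (𝓞 K))} (hS : S.Finite) (hur : ∀ v ∉ S, ψ.IsUnramifiedAt v) :
    ∃ g : ℂ → ℂ, Differentiable ℂ g ∧ (∀ s₀ : ℂ, s₀.re = 1 → g s₀ ≠ 0) ∧ ∀ s : ℂ, 1 < s.re →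
      g s = ∏' v : {v : HeightOneSpectrum (𝓞 K) // v ∉ S},
        (1 - ψ.valueAtUniformizer v.1 * ((v.1.residueCard : ℂ) ^ (-s)))⁻¹ := by
  classical
  obtain ⟨T, rfl⟩ : ∃ T : Finset (HeightOneSpectrum (𝓞 K)), (T : Set _) = S :=
    ⟨hS.toFinset, hS.coe_toFinset⟩
  -- an auxiliary automorphic measure of `GL_1`, to realise `ψ` in `L²`
  obtain ⟨μ, hμ⟩ := AdelicGroupData.exists_isAutomorphicMeasure_gl_holds 1 K
  haveI := hμ
  -- `ψ⁻¹` is unitary, trivial on `A_G`, `≠ 1`, unramified off `S`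
  have hu' : ψ⁻¹.IsUnitary := hu.inv
  have hA' : ∀ t : ℝ≥0ˣ, ψ⁻¹ (posRealIdele K t) = 1 := fun t => by
    rw [HeckeCharacter.inv_apply, hA t, inv_one]
  have h1' : ψ⁻¹ ≠ 1 := inv_ne_one.mpr h1
  have hur' : ∀ v ∉ (T : Set (HeightOneSpectrum (𝓞 K))), ψ⁻¹.IsUnramifiedAt v := fun v hv =>
    HeckeCharacter.isUnramifiedAt_inv_iff.mpr (hur v hv)
  -- Hecke's entire continuations of `L^S(s, ψ)` and `L^S(s, ψ⁻¹)`
  obtain ⟨g, hg, hg_eq⟩ := exists_entire_eq_partialHeckeL μ ψ hu hA h1 hS hur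
  obtain ⟨g', hg', hg'_eq⟩ := exists_entire_eq_partialHeckeL μ ψ⁻¹ hu' hA' h1' hS hur'
  -- continuations of the full `L(s, ψ^{±1})` to `Re s > 0`
  obtain ⟨hG, hG_eq⟩ := differentiableOn_inv_prod_mul_and_eq_heckeLFunction hu T hur hg hg_eq
  obtain ⟨hG', hG'_eq⟩ := differentiableOn_inv_prod_mul_and_eq_heckeLFunction hu' T hur' hg' hg'_eq
  refine ⟨g, hg, fun s₀ hs₀ => ?_, hg_eq⟩
  -- Hecke–Landau on the line: `E(s₀)⁻¹ g(s₀) ≠ 0`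
  have hne := HeckeCharacter.continuation_apply_ne_zero_of_re_eq_one_of_differentiableOn hu hG hG_eq
    hG' hG'_eq hs₀
  exact right_ne_zero_of_mul hne

/-- **Hecke–Landau on `Re s = 1` in limit form, unconditionally** (the statement of
`exists_ne_zero_tendsto_partialHeckeL_of_tate_of_re_eq_one`, `PairLFunctionPolesGLOneBoundaryProofs`,
without its hypothesis `hT`): for unitary `ψ ≠ 1` trivial on `A_G`, finite `S` off which `ψ` is
unramified, and `Re s₀ = 1`, `L^S(s, ψ) → c ≠ 0` as `s → s₀`, `Re s > 1` (`c = g(s₀)`).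
[cite: Iwasawa2019, Ch. 4 §4.2 Prop. 4.4] -/
theorem exists_ne_zero_tendsto_partialHeckeL_of_re_eq_one (ψ : HeckeCharacter K)
    (hu : ψ.IsUnitary) (hA : ∀ t : ℝ≥0ˣ, ψ (posRealIdele K t) = 1) (h1 : ψ ≠ 1)
    {S : Set (HeightOneSpectrum (𝓞 K))} (hS : S.Finite) (hur : ∀ v ∉ S, ψ.IsUnramifiedAt v)
    {s₀ : ℂ} (hs₀ : s₀.re = 1) :
    ∃ c : ℂ, c ≠ 0 ∧ Tendsto (fun s : ℂ => ∏' v : {v : HeightOneSpectrum (𝓞 K) // v ∉ S},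
      (1 - ψ.valueAtUniformizer v.1 * ((v.1.residueCard : ℂ) ^ (-s)))⁻¹)
      (𝓝[{s : ℂ | 1 < s.re}] s₀) (𝓝 c) := by
  obtain ⟨g, hg, hg0, hg_eq⟩ := exists_entire_forall_ne_zero_eq_partialHeckeL ψ hu hA h1 hS hur
  refine ⟨g s₀, hg0 s₀ hs₀, ?_⟩
  have hc : Tendsto g (𝓝[{s : ℂ | 1 < s.re}] s₀) (𝓝 (g s₀)) :=
    (hg s₀).continuousAt.tendsto.mono_left nhdsWithin_le_nhds
  exact hc.congr' (by filter_upwards [self_mem_nhdsWithin] with s hs using hg_eq s hs)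

/-! ### Arthur–Clozel (2.2) on `Re s = 1`, `s ≠ 1`, `n = m = 1`, over every number field -/

section Assembly

variable {μ μ' : Measure (gl 1 K).automorphicQuotient} [(gl 1 K).IsAutomorphicMeasure μ]
  [(gl 1 K).IsAutomorphicMeasure μ']

/-- `1(ϖ_v) = 1` for the trivial Hecke character (a private copy of
`HeckeCharacter.valueAtUniformizer_one` of `ArtinLFunctionsAbelianProofs`, not imported here, as in
the siblings `PairLFunctionPolesGLOne{Rat,Dedekind,Boundary}Proofs`). [folklore] -/
private theorem valueAtUniformizer_one_boundary' (v : HeightOneSpectrum (𝓞 K)) :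
    (1 : HeckeCharacter K).valueAtUniformizer v = 1 := by
  rw [HeckeCharacter.valueAtUniformizer, HeckeCharacter.localComponent_apply,
    HeckeCharacter.one_apply, Units.val_one]

/-- **Arthur–Clozel (2.2) at the points `s₀ ≠ 1` of `Re s = 1`, ranks `n = m = 1`, over every
number field `K`, unconditionally.** The named fact `JacquetShalika1981_partialPairL_boundary_of_ne_one`
holds for `n = m = 1` over `K`: for cuspidal `π` (measure `μ`) and `π'` (measure `μ'`) of
`GL_1(𝔸_K)` with honest Satake families off a finite `S`, and `Re s₀ = 1`, `s₀ ≠ 1`,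
`L^S(s, π × π') = L^S(s, χ_π χ_{π'})` (`CuspidalAutomorphicRepGL.partialPairL_eq_tprod_heckeCharacter₂`)
has a finite non-zero limit as `s → s₀`, `Re s > 1`: for `χ_π χ_{π'} = 1` this is `ζ_K^S(s₀) ≠ 0`
(Landau 1903, `tendsto_tprod_eulerFactor_one_of_ne_one_numberField`), otherwise Hecke–Landau on the
line (`exists_ne_zero_tendsto_partialHeckeL_of_re_eq_one`). This discharges the hypothesis of
`JacquetShalika1981_partialPairL_boundary_of_ne_one_one_of_tate` and extends `…_one_rat` (`K = ℚ`).
[cite: ArthurClozelAMS120, Ch. 3 §2 (2.2)] [cite: Iwasawa2019, Ch. 4 §4.2 Prop. 4.4] -/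
theorem JacquetShalika1981_partialPairL_boundary_of_ne_one_one :
    JacquetShalika1981_partialPairL_boundary_of_ne_one (n := 1) (m := 1) (K := K) (μ := μ)
      (μ' := μ') := by
  intro _ _ P P' S hS α β hα hβ s₀ hs₀ hs₁
  have hfun : partialPairL S α β = fun s : ℂ => ∏' v : {v : HeightOneSpectrum (𝓞 K) // v ∉ S},
      (1 - (P.heckeCharacter * P'.heckeCharacter).valueAtUniformizer v.1 *
        ((v.1.residueCard : ℂ) ^ (-s)))⁻¹ :=
    funext (CuspidalAutomorphicRepGL.partialPairL_eq_tprod_heckeCharacter₂ hα hβ)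
  by_cases hψ : P.heckeCharacter * P'.heckeCharacter = 1
  · obtain ⟨c, hc, hlim⟩ :=
      tendsto_tprod_eulerFactor_one_of_ne_one_numberField (K := K) hS (le_of_eq hs₀.symm) hs₁
    refine ⟨c, hc, ?_⟩
    rw [hfun, hψ]
    simp only [valueAtUniformizer_one_boundary', one_mul]
    exact hlim
  · obtain ⟨c, hc, hlim⟩ := exists_ne_zero_tendsto_partialHeckeL_of_re_eq_one _
      (P.isUnitary_heckeCharacter.mul P'.isUnitary_heckeCharacter)
      (fun t => by rw [HeckeCharacter.mul_apply, P.heckeCharacter_posRealIdele,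
        P'.heckeCharacter_posRealIdele, one_mul]) hψ hS
      (fun v hv => (hα.isUnramifiedAt_heckeCharacter hv).mul (hβ.isUnramifiedAt_heckeCharacter hv))
      hs₀
    refine ⟨c, hc, ?_⟩
    rw [hfun]
    exact hlim

end Assembly

end Literature.NumberTheory.Automorphic
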